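import Literature.IUT.HodgeTheaters.TemperedCoveringsCor23viHatIncidenceOfPSCAbutment
import Literature.IUT.HodgeTheaters.TemperedCoveringsCor23viOfCuspEdgeDict
import HarnessLib

/-!
# [IUTchI] Cor. 2.3 (vi) at the genuine 𝔛-datum — KNIT: the origin datum `PiData.CuspOpenEdgeDict` BY NAME and the
# pro-`Σ̂` cusp incidence BY NAME over abc-iut-L3's [NodNon] Lem. 1.7 predicate of the generized PSC datum (row R41, sequel)

S. Mochizuki, *Inter-universal Teichmüller theory I*, kurims manuscript (May 2020), §2, Cor. 2.3 (vi) p. 48 l. 6–16, proof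
p. 49 l. 62–64 [cite: Mochizuki2012, Cor 2.3(vi) pp.48-49] (D-0012 claim key; series status DISPUTED; nothing of the series is
asserted here); Y. Hoshi, S. Mochizuki, Hiroshima Math. J. **41** (2011), Lemma 1.7 p. 290 [cite: HoshiMochizukiNodNon2011,
Lem 1.7 p.290]; Y. Hoshi, S. Mochizuki, Adv. Stud. Pure Math. **63** (2012), Def. 2.8 / Prop. 2.9 (i) p. 44
[cite: HoshiMochizukiCbTpI2012, Prop 2.9(i) p.44]; S. Mochizuki, Publ. RIMS **42** (2006), Ex. 3.10 p. 44, Thm. 3.7 (iii)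
p. 41 [cite: MochizukiSemiAnbd2006, Thm 3.7(iii) p.41].

PROOF-ONLY knit (abc-iut cell, seat abc-iut-w4-d070 gen 12, L5 ROWS #6 row R41, sequel of
`TemperedCoveringsCor23viHatIncidenceOfPSCAbutment.lean`; cone row `IUTchI:Cor2.3(vi)`; no definition, no instance, no new
`Prop` fact).  Composes BY NAME: abc-iut-L3's origin datum `SpecialFibreTower.PiData.CuspOpenEdgeDict` (p496160) as the single
displayed dictionary hypothesis `(hdict : P.CuspOpenEdgeDict)` exactly as in abc-iut-L5-d5's knit
`cor23vi_ofSpecialFibre_closureH_of_piData_of_hatCuspIncidence_of_cuspOpenEdgeDict` (p496337), whose remaining binder `hFcusp`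
(pro-`Σ̂` CUSP–subgraph incidence, FACT-candidate G-w4d059-g8-1) is here SUPPLIED BY NAME from abc-iut-w5-d174's [NodNon] Lem. 1.7
predicate `PSCDatum.EdgeVerticialAbutment` (p493760) of a displayed generized pro-`Σ̂` PSC datum `Q` on `Π̂_𝔾` with its
[CbTpI] Prop. 2.9 (i) dictionary (this seat's `hatCuspIncidence_of_pscAbutment`):

* `hatIncidence_verticialOver_of_hatCuspIncidence_of_cuspOpenEdgeDict` — abc-iut-L5-d5's GROUP-form law `hhatV` ⟸ `hFcusp` +
  `P.CuspOpenEdgeDict` (the cusp edge is OPEN: abc-iut-w4-d059's `exists_branch_abuts_none_of_cuspOpenEdgeDict`; then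
  [SemiAnbd] Thm. 3.7 (iii) via this lineage's `hcusp_of_edgeLike`);
* **`cor23vi_ofSpecialFibre_closureH_of_piData_of_pscAbutment_of_cuspOpenEdgeDict`** — row `IUTchI:Cor2.3(vi)` over the
  origin record, PRINT'S record-vertex atom, any `Π^tp_ℍ := TpH ∈ decompSubgroups S.chart P.H`: binders
  {`hdict : P.CuspOpenEdgeDict` (ORIGIN record datum), `Q`, `v_ℍ` (DATA: the generization `𝒢⇝ℍ`),
  `hAb : Q.EdgeVerticialAbutment` (NAMED L3 predicate), (g1) `hvH`, (g2, open edges) `hEopen` (ORIGIN dictionary)} — LAW 0,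
  FACT-INSTANCE 0, no unnamed `∀`-law;
* `cor23vi_ofSpecialFibre_verticialOver_piDataTpH_of_pscAbutment_of_cuspOpenEdgeDict` — the same for abc-iut-L5-d5's
  GROUP-form atom at the record's `Π^tp_ℍ := P.TpH`.

BINDER CENSUS (classes as in the parent file): `hdict` ORIGIN (record datum, policy D) · `Q vH` DATA (origin class: the
generized pro-`Σ̂` PSC-type datum on `Π̂_𝔾`, not constructed in the tree) · `hAb` NAMED-L3-PREDICATE ([NodNon] Lem. 1.7,
instance-proved at abc-iut-L3's carriers) · `hvH`, `hEopen` ORIGIN dictionary ([CbTpI] Prop. 2.9 (i) / Def. 2.8) · LAW 0 ·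
FACT-INSTANCE 0.  HONEST FRAMING: a by-name composition, no new mathematics; model-RELATIVE (the genuine datum
`ofSpecialFibre`); an origin datum is a hypothesis asserted for no curve; typed ≠ discharged for the [IUTchI] claim keys;
nothing here bears on [IUTchIII] Cor. 3.12 or asserts that abc is proved or refuted.
-/

noncomputable section

namespace Literature.IUT.HodgeTheaters

open _root_.Topology
open scoped Pointwise
open Literature.AnabelianGeometry.SemiGraphs
open Literature.AnabelianGeometry.SemiGraphs.ProfiniteSemiGraph

universe u

namespace StableCurveTemperedData

variable {p : ℕ} [Fact p.Prime] (X : TemperedCurve p) (d : X.GroupLevelData)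
  (S : SpecialFibreData (X.toTemperedArithmeticGroup d)) (h36 : S.Gc.Prop36Hypotheses)
  (Sigma SigmaHat : Set ℕ) (hsub : Sigma ⊆ SigmaHat) (hne : Sigma.Nonempty)
  (hprime : ∀ q ∈ SigmaHat, q.Prime) (hp : p ∉ Sigma)
  (TpH : Subgroup S.chart.G)
  {T : SpecialFibreTower X.DeltaTemp} (P : SpecialFibreTower.PiData X d S T)

/-! ### 1. The group-form law from the cusp-only incidence and the origin datum -/

include h36 in
/-- **abc-iut-L5-d5's group-form residual `hhatV` ⟸ `hFcusp` + the origin datum `P.CuspOpenEdgeDict`**: the cusp edge `e_x`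
is OPEN and carries `J_x` as an edge-like subgroup, so `hFcusp` yields a branch of `e_x` at a vertex `w ∈ ℍ`, and `J_x` lies in
a verticial subgroup at `w` ([SemiAnbd] Thm. 3.7 (iii)).  General `ℍ`, `Π^tp_ℍ := TpH`.
[cite: MochizukiSemiAnbd2006, Thm 3.7(iii) p.41] -/
theorem hatIncidence_verticialOver_of_hatCuspIncidence_of_cuspOpenEdgeDict (hdict : P.CuspOpenEdgeDict)
    {H : S.Gc.graph.Subgraph}
    (hFcusp : ∀ (e : S.Gc.graph.Edge),
      (∃ b₀ : S.Gc.graph.Branch, S.Gc.graph.edgeOf b₀ = e ∧ S.Gc.graph.abuts b₀ = none) →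
      ∀ L ∈ edgeLikeSubgroups S.chart e,
      ∀ g : (TemperedGraphGroupData.exists_completion_of_prop36 S.Gc h36 S.chart).choose,
        L.map (TemperedGraphGroupData.exists_completion_of_prop36 S.Gc h36 S.chart).choose_spec.choose.toMonoidHom ≤
          MulAut.conj g • (TpH.map (TemperedGraphGroupData.exists_completion_of_prop36 S.Gc h36
            S.chart).choose_spec.choose.toMonoidHom).topologicalClosure →
        ∃ b : S.Gc.graph.Branch, S.Gc.graph.edgeOf b = e ∧ ∃ w ∈ H.verts, S.Gc.graph.abuts b = some w) :
    ∀ x : {x : X.Pt // X.IsCusp x},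
      (∃ g : (TemperedGraphGroupData.exists_completion_of_prop36 S.Gc h36 S.chart).choose,
        (((X.inertia x.1).subgroupOf (X.toTemperedArithmeticGroup d).delta).map S.admissible.toMonoidHom).map
            (TemperedGraphGroupData.exists_completion_of_prop36 S.Gc h36 S.chart).choose_spec.choose.toMonoidHom ≤
          MulAut.conj g • (TpH.map (TemperedGraphGroupData.exists_completion_of_prop36 S.Gc h36
            S.chart).choose_spec.choose.toMonoidHom).topologicalClosure) →
      ∃ v ∈ H.verts, ∃ K ∈ verticialSubgroups S.chart v,
        ((X.inertia x.1).subgroupOf (X.toTemperedArithmeticGroup d).delta).map S.admissible.toMonoidHom ≤ K := by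
  intro x hx
  obtain ⟨g, hg⟩ := hx
  obtain ⟨b, -, hother, hJ⟩ := hdict x
  obtain ⟨b₁, hb₁e, w, hwH, hb₁w⟩ :=
    hFcusp (S.Gc.graph.edgeOf b) (exists_branch_abuts_none_of_cuspOpenEdgeDict X d S hother) _ hJ g hg
  exact ⟨w, hwH, hcusp_of_edgeLike X d S h36 (fun _ => w) x ⟨b₁, hb₁w, _, hb₁e ▸ hJ, le_rfl⟩⟩

/-! ### 2. Row `IUTchI:Cor2.3(vi)` over the origin record: dictionary BY NAME, incidence BY NAME over the L3 predicate -/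

/-- **Row `IUTchI:Cor2.3(vi)` over abc-iut-L3's origin record, PRINT'S record-vertex cusp predicate
`x ↦ (P.proj i)(P.vtxOfCusp i x) ∈ ℍ`, `ℍ := P.H`, any `Π^tp_ℍ := TpH ∈ decompSubgroups S.chart P.H`, print's `Π̂_ℍ`** —
abc-iut-L5-d5's knit (p496337) with its last binder `hFcusp` SUPPLIED from `Q.EdgeVerticialAbutment` ([NodNon] Lem. 1.7, NAMED L3
predicate of the generized pro-`Σ̂` PSC datum `Q` on `Π̂_𝔾`) + the [CbTpI] Prop. 2.9 (i) dictionary (g1) (g2, open edges).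
Displayed: `hdict` (ORIGIN record datum), `Q vH` (DATA), `hAb` (NAMED), `hvH hEopen` (ORIGIN dictionary).  FQ type per the gate
rule. [cite: Mochizuki2012, Cor 2.3(vi) pp.48-49] [claim: Mochizuki2012, status: disputed] -/
theorem cor23vi_ofSpecialFibre_closureH_of_piData_of_pscAbutment_of_cuspOpenEdgeDict (hdict : P.CuspOpenEdgeDict) (i : ℕ)
    (hTpH : TpH ∈ S.chart.decompSubgroups P.H)
    (Q : PSCDatum (TemperedGraphGroupData.exists_completion_of_prop36 S.Gc h36 S.chart).choose) (vH : Q.graph.V)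
    (hAb : Q.EdgeVerticialAbutment)
    (hvH : ∃ γ : (TemperedGraphGroupData.exists_completion_of_prop36 S.Gc h36 S.chart).choose,
      MulAut.conj γ • Q.vertGp vH = (TpH.map (TemperedGraphGroupData.exists_completion_of_prop36 S.Gc h36
        S.chart).choose_spec.choose.toMonoidHom).topologicalClosure)
    (hEopen : ∀ e : S.Gc.graph.Edge, (∃ b₀ : S.Gc.graph.Branch, S.Gc.graph.edgeOf b₀ = e ∧ S.Gc.graph.abuts b₀ = none) →
      ∀ L ∈ edgeLikeSubgroups S.chart e, ∃ e' : Q.graph.N ⊕ Q.graph.C,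
        ∃ h : (TemperedGraphGroupData.exists_completion_of_prop36 S.Gc h36 S.chart).choose,
          L.map (TemperedGraphGroupData.exists_completion_of_prop36 S.Gc h36 S.chart).choose_spec.choose.toMonoidHom =
            MulAut.conj h • Q.edgeGp e' ∧
          (Q.graph.Abuts e' vH → ∃ b : S.Gc.graph.Branch, S.Gc.graph.edgeOf b = e ∧
            ∃ w ∈ P.H.verts, S.Gc.graph.abuts b = some w)) :
    Literature.IUT.HodgeTheaters.StableCurveTemperedData.Cor23vi
        (ofSpecialFibre X d S h36 Sigma SigmaHat hsub hne hprime hp TpH ((TpH.map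
          (TemperedGraphGroupData.exists_completion_of_prop36 S.Gc h36 S.chart).choose_spec.choose.toMonoidHom
          ).topologicalClosure) (Subgroup.le_topologicalClosure _)
          (fun x => (P.proj i).vertexMap (P.vtxOfCusp i x) ∈ P.H.verts)) :=
  cor23vi_ofSpecialFibre_closureH_of_piData_of_hatCuspIncidence_of_cuspOpenEdgeDict X d S h36 Sigma SigmaHat hsub hne hprime
    hp TpH P hdict i hTpH (hatCuspIncidence_of_pscAbutment S.chart _ P.H TpH Q vH hAb hvH hEopen)

/-- **Row `IUTchI:Cor2.3(vi)` over the origin record, abc-iut-L5-d5's GROUP-form atom at the record's `Π^tp_ℍ := P.TpH`** —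
binders {`hdict : P.CuspOpenEdgeDict`, `Q`, `v_ℍ`, `hAb : Q.EdgeVerticialAbutment`, (g1) `hvH`, (g2, open edges) `hEopen`};
abc-iut-L5-d5's `cor23vi_ofSpecialFibre_verticialOver_piDataTpH` with `hhatV` so supplied.  FQ type per the gate rule.
[cite: Mochizuki2012, Cor 2.3(vi) pp.48-49] [claim: Mochizuki2012, status: disputed] -/
theorem cor23vi_ofSpecialFibre_verticialOver_piDataTpH_of_pscAbutment_of_cuspOpenEdgeDict (hdict : P.CuspOpenEdgeDict)
    (Q : PSCDatum (TemperedGraphGroupData.exists_completion_of_prop36 S.Gc h36 S.chart).choose) (vH : Q.graph.V)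
    (hAb : Q.EdgeVerticialAbutment)
    (hvH : ∃ γ : (TemperedGraphGroupData.exists_completion_of_prop36 S.Gc h36 S.chart).choose,
      MulAut.conj γ • Q.vertGp vH = (P.TpH.map (TemperedGraphGroupData.exists_completion_of_prop36 S.Gc h36
        S.chart).choose_spec.choose.toMonoidHom).topologicalClosure)
    (hEopen : ∀ e : S.Gc.graph.Edge, (∃ b₀ : S.Gc.graph.Branch, S.Gc.graph.edgeOf b₀ = e ∧ S.Gc.graph.abuts b₀ = none) →
      ∀ L ∈ edgeLikeSubgroups S.chart e, ∃ e' : Q.graph.N ⊕ Q.graph.C,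
        ∃ h : (TemperedGraphGroupData.exists_completion_of_prop36 S.Gc h36 S.chart).choose,
          L.map (TemperedGraphGroupData.exists_completion_of_prop36 S.Gc h36 S.chart).choose_spec.choose.toMonoidHom =
            MulAut.conj h • Q.edgeGp e' ∧
          (Q.graph.Abuts e' vH → ∃ b : S.Gc.graph.Branch, S.Gc.graph.edgeOf b = e ∧
            ∃ w ∈ P.H.verts, S.Gc.graph.abuts b = some w)) :
    Literature.IUT.HodgeTheaters.StableCurveTemperedData.Cor23vi
        (ofSpecialFibre X d S h36 Sigma SigmaHat hsub hne hprime hp P.TpH ((P.TpH.map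
          (TemperedGraphGroupData.exists_completion_of_prop36 S.Gc h36 S.chart).choose_spec.choose.toMonoidHom
          ).topologicalClosure) (Subgroup.le_topologicalClosure _)
          (fun x => ∃ v ∈ P.H.verts, ∃ K ∈ verticialSubgroups S.chart v,
            ((X.inertia x.1).subgroupOf (X.toTemperedArithmeticGroup d).delta).map S.admissible.toMonoidHom ≤ K)) :=
  cor23vi_ofSpecialFibre_verticialOver_piDataTpH X d S h36 Sigma SigmaHat hsub hne hprime hp P
    (hatIncidence_verticialOver_of_hatCuspIncidence_of_cuspOpenEdgeDict X d S h36 P.TpH P hdict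
      (hatCuspIncidence_of_pscAbutment S.chart _ P.H P.TpH Q vH hAb hvH hEopen))

end StableCurveTemperedData

end Literature.IUT.HodgeTheaters

end
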